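import Mathlib.Analysis.Complex.Harmonic.Analytic
import Mathlib.Analysis.Complex.RemovableSingularity
import Mathlib.Analysis.Complex.Liouville
import Mathlib.Analysis.InnerProductSpace.Harmonic.Constructions
import Mathlib.Analysis.InnerProductSpace.Calculus
import Mathlib.Analysis.SpecialFunctions.Complex.Log
import Mathlib.MeasureTheory.Integral.CircleIntegral
import Literature.Topology.Euclidean.PlanarStaircase

/-!
# Removable singularities of bounded harmonic functions in the plane

**Theorem (classical; Bôcher–Riemann removable singularity theorem for harmonic functions, planar
case).** Let `u` be harmonic on a punctured disc `B(v,R) ∖ {v} ⊆ ℂ` and bounded there. Then `u`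
extends to a harmonic function on `B(v,R)`. [folklore]

This is the extension theorem "around singularities for harmonic functions" invoked in
H. Duminil-Copin, K. K. Kozlowski, P. Lammers, I. Manolescu, *Gaussian free field convergence of the
six-vertex model with `-1 ≤ Δ ≤ -1/2`*, arXiv:2603.06268 (2026), Part II §2 (proof of Theorem 48:
harmonicity plus the analysis of the singularities determines `Ψ_k`). [cite: DKLM2026SixVertexGFF,
Part II, §2, proof of Theorem 48]

Proof (complex-analytic, Mathlib-only). Let `g = 2∂u = u_x - i u_y`, holomorphic on the punctured
disc (`HarmonicAt.differentiableAt_complex_partial`). Locally `u = Re G` with `G' = g`; the Cauchy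
estimate applied to `e^{G}` (`|e^G| = e^u ≤ e^M`) gives the interior gradient bound
`|g(z)| ≤ 2e^{2M}/dist(z,v)`, so `(z-v)g(z)` is bounded near `v`, hence has a removable singularity:
`g = a/(z-v) + h` with `h` holomorphic on `B(v,R)`. The real part of `∮ g dz` over a circle is
`∮ du = 0`, whence `a ∈ ℝ`. With `H` a primitive of `h` on the disc, `u - a log|z-v| - Re H` has zero
differential on the punctured disc (connected:
`Literature/Topology/Euclidean/PlanarStaircase.lean`), so it is a constant `κ`; boundedness of `u` forces
`a = 0`, and `Re H + κ` is the harmonic extension.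
-/

noncomputable section

open Complex InnerProductSpace Metric Set Filter Topology

namespace Literature.Analysis.Complex

/-! ## 1. The complex gradient `2∂u` -/

/-- The complex gradient `2∂u(z) = u_x(z) - i u_y(z)` of a real function on `ℂ`. [folklore] -/
def cgrad (u : ℂ → ℝ) (z : ℂ) : ℂ := ((fderiv ℝ u z 1 : ℝ) : ℂ) - I * ((fderiv ℝ u z I : ℝ) : ℂ)

/-- At a harmonic point, `2∂u` is complex differentiable (Mathlib:
`HarmonicAt.differentiableAt_complex_partial`). [folklore] -/
theorem differentiableAt_cgrad {u : ℂ → ℝ} {z : ℂ} (h : HarmonicAt u z) : DifferentiableAt ℂ (cgrad u) z :=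
  HarmonicAt.differentiableAt_complex_partial h

/-- The real differential in terms of the complex gradient: `du_z(w) = Re(2∂u(z)·w)`. [folklore] -/
theorem fderiv_apply_eq_re_cgrad_mul (u : ℂ → ℝ) (z w : ℂ) : fderiv ℝ u z w = (cgrad u z * w).re := by
  have hw : w = w.re • (1 : ℂ) + w.im • I := by
    apply Complex.ext <;> simp
  conv_lhs => rw [hw]
  rw [map_add, map_smul, map_smul]
  simp only [cgrad, smul_eq_mul, Complex.sub_re, Complex.mul_re, Complex.ofReal_re, Complex.ofReal_im, Complex.I_re,
    Complex.I_im, Complex.mul_im, Complex.sub_im]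
  ring

/-- If `u = Re G` near `z` with `G` complex differentiable at `z`, then `G'(z) = 2∂u(z)`
(Cauchy–Riemann). [folklore] -/
theorem deriv_eq_cgrad_of_re_eq {u : ℂ → ℝ} {G : ℂ → ℂ} {z : ℂ} {s : Set ℂ} (hs : s ∈ 𝓝 z)
    (hG : DifferentiableAt ℂ G z) (hre : EqOn (fun w => (G w).re) u s) : deriv G z = cgrad u z := by
  have h1 : fderiv ℝ u z = reCLM.comp ((fderiv ℂ G z).restrictScalars ℝ) := by
    have heq : u =ᶠ[𝓝 z] fun w => (G w).re :=
      (eventuallyEq_of_mem hs fun w hw => (hre hw).symm)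
    rw [heq.fderiv_eq]
    exact (reCLM.hasFDerivAt.comp z (hG.hasFDerivAt.restrictScalars ℝ)).fderiv
  have happ : ∀ w : ℂ, fderiv ℝ u z w = (deriv G z * w).re := by
    intro w
    rw [h1]
    have : (fderiv ℂ G z : ℂ → ℂ) w = w * deriv G z := by
      rw [← fderiv_apply_one_eq_deriv, ← smul_eq_mul, ← ContinuousLinearMap.map_smul, smul_eq_mul, mul_one]
    simp only [ContinuousLinearMap.coe_comp, Function.comp_apply, ContinuousLinearMap.coe_restrictScalars', reCLM_apply]
    rw [this, mul_comm]
  rw [cgrad, happ 1, happ I]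
  apply Complex.ext <;> simp

/-- **Interior gradient bound.** If `u` is harmonic with `|u| ≤ M` on `B(z,ρ)`, then
`|2∂u(z)| ≤ 2e^{2M}/ρ` (Cauchy estimate for `e^{G}`, `u = Re G`). [folklore] -/
theorem norm_cgrad_le {u : ℂ → ℝ} {z : ℂ} {ρ M : ℝ} (hρ : 0 < ρ) (hu : ∀ w ∈ ball z ρ, HarmonicAt u w)
    (hM : ∀ w ∈ ball z ρ, |u w| ≤ M) : ‖cgrad u z‖ ≤ 2 * Real.exp (2 * M) / ρ := by
  obtain ⟨G, hGa, hGre⟩ :=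
    InnerProductSpace.HarmonicOnNhd.exists_analyticOnNhd_ball_re_eq (f := u) (z := z) (R := ρ) hu
  have hGd : DifferentiableOn ℂ G (ball z ρ) := hGa.differentiableOn
  have hGz : DifferentiableAt ℂ G z := hGd.differentiableAt (ball_mem_nhds z hρ)
  have hderiv : deriv G z = cgrad u z := deriv_eq_cgrad_of_re_eq (ball_mem_nhds z hρ) hGz hGre
  set F : ℂ → ℂ := fun w => exp (G w) with hF
  have hFd : DifferentiableOn ℂ F (ball z ρ) := hGd.cexp
  have hsub : closedBall z (ρ / 2) ⊆ ball z ρ := closedBall_subset_ball (by linarith)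
  have hFc : DiffContOnCl ℂ F (ball z (ρ / 2)) := hFd.diffContOnCl_ball hsub
  have hbound : ∀ w ∈ sphere z (ρ / 2), ‖F w‖ ≤ Real.exp M := by
    intro w hw
    have hw' : w ∈ ball z ρ := hsub (sphere_subset_closedBall hw)
    rw [hF]
    simp only
    have hre : (G w).re = u w := hGre hw'
    rw [Complex.norm_exp, hre]
    exact Real.exp_le_exp.2 ((le_abs_self _).trans (hM w hw'))
  have hC := Complex.norm_deriv_le_of_forall_mem_sphere_norm_le (by positivity) hFc hbound
  have hFz : deriv F z = exp (G z) * deriv G z := (hGz.hasDerivAt.cexp).deriv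
  have huz : |u z| ≤ M := hM z (mem_ball_self hρ)
  have hexp_pos : 0 < Real.exp (u z) := Real.exp_pos _
  have hrez : (G z).re = u z := hGre (mem_ball_self hρ)
  have hnorm : ‖cgrad u z‖ = ‖deriv F z‖ * Real.exp (-(u z)) := by
    rw [← hderiv, hFz, norm_mul, Complex.norm_exp, hrez, Real.exp_neg]
    field_simp
  rw [hnorm]
  have h1 : Real.exp (-(u z)) ≤ Real.exp M := Real.exp_le_exp.2 (by linarith [neg_abs_le (u z)])
  calc ‖deriv F z‖ * Real.exp (-(u z)) ≤ Real.exp M / (ρ / 2) * Real.exp M := by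
        gcongr
    _ = 2 * Real.exp (2 * M) / ρ := by
        rw [show (2 : ℝ) * M = M + M by ring, Real.exp_add]
        field_simp

/-! ## 2. `Re ∮ 2∂u dz = 0` over circles (the punctured disc is connected:
`Literature.Topology.Euclidean.isPreconnected_ball_diff_singleton`) -/

/-- Along a circle on which `u` is harmonic, `θ ↦ 2∂u(c(θ))` is continuous. [folklore] -/
theorem continuous_cgrad_circleMap {u : ℂ → ℝ} {v : ℂ} {r : ℝ} (hr : 0 ≤ r) (hu : ∀ z ∈ sphere v r, HarmonicAt u z) :
    Continuous fun θ : ℝ => cgrad u (circleMap v r θ) :=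
  continuous_iff_continuousAt.2 fun θ =>
    ((differentiableAt_cgrad (hu _ (circleMap_mem_sphere v hr θ))).continuousAt).comp (continuous_circleMap v r).continuousAt

/-- **`Re ∮ 2∂u dz = ∮ du = 0`** over a circle on which `u` is harmonic. [folklore] -/
theorem re_circleIntegral_cgrad (u : ℂ → ℝ) {v : ℂ} {r : ℝ} (hr : 0 ≤ r) (hu : ∀ z ∈ sphere v r, HarmonicAt u z) :
    (∮ z in C(v, r), cgrad u z).re = 0 := by
  have hcont : Continuous fun θ : ℝ => deriv (circleMap v r) θ • cgrad u (circleMap v r θ) := by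
    simp_rw [deriv_circleMap]
    exact ((continuous_circleMap 0 r).mul continuous_const).smul (continuous_cgrad_circleMap hr hu)
  rw [circleIntegral, ← reCLM_apply, ← ContinuousLinearMap.intervalIntegral_comp_comm _ (hcont.intervalIntegrable _ _)]
  have hderiv : ∀ θ : ℝ, HasDerivAt (fun θ => u (circleMap v r θ))
      (reCLM (deriv (circleMap v r) θ • cgrad u (circleMap v r θ))) θ := by
    intro θ
    have hdu : DifferentiableAt ℝ u (circleMap v r θ) :=
      (hu _ (circleMap_mem_sphere v hr θ)).1.differentiableAt two_ne_zero
    have h := hdu.hasFDerivAt.comp_hasDerivAt θ (hasDerivAt_circleMap v r θ)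
    rw [fderiv_apply_eq_re_cgrad_mul] at h
    refine h.congr_deriv ?_
    rw [reCLM_apply, deriv_circleMap, smul_eq_mul]
    congr 1
    ring
  rw [intervalIntegral.integral_eq_sub_of_hasDerivAt (fun θ _ => hderiv θ)
    ((reCLM.continuous.comp hcont).intervalIntegrable _ _)]
  have := periodic_circleMap v r 0
  rw [zero_add] at this
  rw [this, sub_self]

/-! ## 3. The removable singularity theorem -/

/-- **Removable singularity theorem for bounded harmonic functions (planar case).** A function
harmonic and bounded on a punctured disc `B(v,R) ∖ {v}` agrees there with a function harmonic on
`B(v,R)`. [folklore; invoked in [cite: DKLM2026SixVertexGFF, Part II, §2, proof of Theorem 48]] -/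
theorem exists_harmonicOnNhd_ball_eqOn_of_bounded {u : ℂ → ℝ} {v : ℂ} {R M : ℝ} (hR : 0 < R)
    (hu : ∀ z ∈ ball v R \ {v}, HarmonicAt u z) (hM : ∀ z ∈ ball v R \ {v}, |u z| ≤ M) :
    ∃ U : ℂ → ℝ, HarmonicOnNhd U (ball v R) ∧ EqOn U u (ball v R \ {v}) := by
  set D : Set ℂ := ball v R \ {v} with hD
  have hDo : IsOpen D := isOpen_ball.sdiff isClosed_singleton
  have hmemD : ∀ {z : ℂ}, z ∈ D ↔ dist z v < R ∧ z ≠ v := fun {z} => by simp [hD, mem_ball]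
  set g : ℂ → ℂ := cgrad u with hg
  have hgd : DifferentiableOn ℂ g D := fun z hz => (differentiableAt_cgrad (hu z hz)).differentiableWithinAt
  -- Step 1: interior gradient bound near `v`
  have hgb : ∀ z ∈ D, dist z v < R / 2 → ‖g z‖ ≤ 2 * Real.exp (2 * M) / ‖z - v‖ := by
    intro z hz hz2
    have hzv : z ≠ v := (hmemD.1 hz).2
    have hρ : 0 < ‖z - v‖ := norm_pos_iff.2 (sub_ne_zero.2 hzv)
    have hsub : ball z ‖z - v‖ ⊆ D := by
      intro w hw
      rw [mem_ball, dist_eq_norm] at hw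
      refine hmemD.2 ⟨?_, ?_⟩
      · rw [dist_eq_norm] at hz2 ⊢
        calc ‖w - v‖ = ‖(w - z) + (z - v)‖ := by ring_nf
          _ ≤ ‖w - z‖ + ‖z - v‖ := norm_add_le _ _
          _ < R := by linarith
      · intro hwv
        rw [hwv, norm_sub_rev] at hw
        exact lt_irrefl _ hw
    exact norm_cgrad_le hρ (fun w hw => hu w (hsub hw)) (fun w hw => hM w (hsub hw))
  -- Step 2: `k = (z - v) g` is bounded near `v`, hence has a removable singularity
  have hsmall : ball v (R / 2) \ {v} ⊆ D := fun z hz =>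
    hmemD.2 ⟨by have := mem_ball.1 hz.1; linarith, hz.2⟩
  set k : ℂ → ℂ := fun z => (z - v) * g z with hk
  have hkd : DifferentiableOn ℂ k (ball v (R / 2) \ {v}) :=
    DifferentiableOn.mul (by fun_prop) (hgd.mono hsmall)
  have hkb : BddAbove (norm ∘ k '' (ball v (R / 2) \ {v})) := by
    refine ⟨2 * Real.exp (2 * M), ?_⟩
    rintro _ ⟨z, hz, rfl⟩
    have hρ : 0 < ‖z - v‖ := norm_pos_iff.2 (sub_ne_zero.2 hz.2)
    simp only [Function.comp_apply, hk, norm_mul]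
    calc ‖z - v‖ * ‖g z‖ ≤ ‖z - v‖ * (2 * Real.exp (2 * M) / ‖z - v‖) := by
          gcongr
          exact hgb z (hsmall hz) (mem_ball.1 hz.1)
      _ = 2 * Real.exp (2 * M) := by field_simp
  set K : ℂ → ℂ := Function.update k v (limUnder (𝓝[≠] v) k) with hK
  have hKd : DifferentiableOn ℂ K (ball v (R / 2)) :=
    Complex.differentiableOn_update_limUnder_of_bddAbove (ball_mem_nhds v (by positivity)) hkd hkb
  set a : ℂ := K v with ha
  have hKz : ∀ z, z ≠ v → K z = (z - v) * g z := fun z hz => by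
    simp only [hK, Function.update_of_ne hz, hk]
  -- Step 3: `g = a/(z-v) + h` with `h` holomorphic on the whole disc
  set h₀ : ℂ → ℂ := dslope K v with hh₀
  have hh₀d : DifferentiableOn ℂ h₀ (ball v (R / 2)) :=
    (Complex.differentiableOn_dslope (ball_mem_nhds v (by positivity))).2 hKd
  have hh₀z : ∀ z, z ≠ v → h₀ z = g z - a / (z - v) := by
    intro z hz
    have hzv : z - v ≠ 0 := sub_ne_zero.2 hz
    rw [hh₀, dslope_of_ne _ hz, slope_def_module, hKz z hz, ← ha, smul_eq_mul]
    field_simp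
  set h : ℂ → ℂ := fun z => if z = v then h₀ v else g z - a / (z - v) with hh
  have hh_ne : ∀ z, z ≠ v → h z = g z - a / (z - v) := fun z hz => by simp only [hh, if_neg hz]
  have hhd : DifferentiableOn ℂ h (ball v R) := by
    intro z hz
    by_cases hzv : z = v
    · subst hzv
      have heq : h =ᶠ[𝓝 z] h₀ := by
        filter_upwards [ball_mem_nhds z (show (0 : ℝ) < R / 2 by positivity)] with w hw
        by_cases hwv : w = z
        · subst hwv
          simp only [hh, if_pos rfl]
        · rw [hh_ne w hwv, hh₀z w hwv]
      exact ((hh₀d.differentiableAt (ball_mem_nhds z (by positivity))).congr_of_eventuallyEq heq).differentiableWithinAt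
    · have hzD : z ∈ D := hmemD.2 ⟨mem_ball.1 hz, hzv⟩
      have heq : h =ᶠ[𝓝 z] fun w => g w - a / (w - v) := by
        filter_upwards [eventually_ne_nhds hzv] with w hw
        exact hh_ne w hw
      have hdiff : DifferentiableAt ℂ (fun w => g w - a / (w - v)) z :=
        (hgd.differentiableAt (hDo.mem_nhds hzD)).sub
          (DifferentiableAt.div (differentiableAt_const _) (by fun_prop) (sub_ne_zero.2 hzv))
      exact (hdiff.congr_of_eventuallyEq heq).differentiableWithinAt
  have hgh : ∀ z ∈ D, g z = a / (z - v) + h z := by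
    intro z hz
    rw [hh_ne z (hmemD.1 hz).2]
    ring
  -- Step 4: `a` is real (`Re ∮ g = 0`)
  have hsphere : sphere v (R / 2) ⊆ D := fun z hz =>
    hmemD.2 ⟨by rw [mem_sphere.1 hz]; linarith, by
      intro hzv
      rw [hzv, mem_sphere, dist_self] at hz
      linarith⟩
  have ha_im : a.im = 0 := by
    have hre := re_circleIntegral_cgrad u (by positivity : (0 : ℝ) ≤ R / 2) (fun z hz => hu z (hsphere hz))
    have hcongr : (∮ z in C(v, R / 2), cgrad u z) = ∮ z in C(v, R / 2), (a • (z - v)⁻¹ + h z) := by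
      refine circleIntegral.integral_congr (by positivity) fun z hz => ?_
      change g z = _
      rw [hgh z (hsphere hz), smul_eq_mul, div_eq_mul_inv]
    have hci : CircleIntegrable (fun z => a • (z - v)⁻¹) v (R / 2) := by
      refine ContinuousOn.circleIntegrable (by positivity) (ContinuousOn.const_smul ?_ a)
      refine ContinuousOn.inv₀ (by fun_prop) fun z hz => sub_ne_zero.2 (hmemD.1 (hsphere hz)).2
    have hch : CircleIntegrable h v (R / 2) :=
      ContinuousOn.circleIntegrable (by positivity)
        (hhd.continuousOn.mono (sphere_subset_closedBall.trans (closedBall_subset_ball (by linarith))))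
    have hh0 : (∮ z in C(v, R / 2), h z) = 0 :=
      Complex.circleIntegral_eq_zero_of_differentiable_on_off_countable (by positivity) countable_empty
        (hhd.continuousOn.mono (closedBall_subset_ball (by linarith)))
        (fun z hz => hhd.differentiableAt (isOpen_ball.mem_nhds (ball_subset_ball (by linarith) hz.1)))
    rw [hcongr, circleIntegral.integral_add hci hch, circleIntegral.integral_smul,
      circleIntegral.integral_sub_inv_of_mem_ball (mem_ball_self (by positivity)), hh0, add_zero] at hre
    simp only [smul_eq_mul, Complex.mul_re, Complex.mul_im, Complex.re_ofNat, Complex.im_ofNat, Complex.ofReal_re,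
      Complex.ofReal_im, Complex.I_re, Complex.I_im] at hre
    have hπ := Real.pi_pos
    nlinarith [hre]
  -- Step 5: a primitive `H` of `h` on the disc
  obtain ⟨H, hH0, hH⟩ := hhd.isExactOn_ball.with_val_at v 0
  -- Step 6: `w = u - (a/2) log |z-v|² - Re H` has zero differential on `D`
  set w : ℂ → ℝ := fun z => u z - a.re / 2 * Real.log (‖z - v‖ ^ 2) - (H z).re with hw
  have hwderiv : ∀ z ∈ D, HasFDerivAt w (0 : ℂ →L[ℝ] ℝ) z := by
    intro z hz
    have hzv : z ≠ v := (hmemD.1 hz).2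
    have hzv' : z - v ≠ 0 := sub_ne_zero.2 hzv
    have hnorm : ‖z - v‖ ^ 2 ≠ 0 := pow_ne_zero _ (norm_ne_zero_iff.2 hzv')
    have h1 : HasFDerivAt u (fderiv ℝ u z) z := ((hu z hz).1.differentiableAt two_ne_zero).hasFDerivAt
    have h2 : HasFDerivAt (fun z : ℂ => a.re / 2 * Real.log (‖z - v‖ ^ 2))
        ((a.re / 2) • ((‖z - v‖ ^ 2)⁻¹ • ((2 : ℕ) • (innerSL ℝ (z - v)).comp (ContinuousLinearMap.id ℝ ℂ)))) z :=
      (((hasFDerivAt_id z).sub_const v).norm_sq.log hnorm).const_mul _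
    have h3 : HasFDerivAt (fun z => (H z).re)
        (reCLM.comp ((ContinuousLinearMap.smulRight (1 : ℂ →L[ℂ] ℂ) (h z)).restrictScalars ℝ)) z :=
      reCLM.hasFDerivAt.comp z ((hH z (hmemD.1 hz |>.1 |> mem_ball.2)).hasFDerivAt.restrictScalars ℝ)
    have hsum := (h1.sub h2).sub h3
    refine hsum.congr_fderiv (ContinuousLinearMap.ext fun q => ?_)
    have hgz := hgh z hz
    simp only [_root_.sub_apply, _root_.smul_apply, ContinuousLinearMap.comp_apply, ContinuousLinearMap.id_apply,
      innerSL_apply_apply, Complex.inner, ContinuousLinearMap.coe_restrictScalars', ContinuousLinearMap.smulRight_apply,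
      one_apply_eq_self, reCLM_apply, _root_.zero_apply, fderiv_apply_eq_re_cgrad_mul, smul_eq_mul]
    change (g z * q).re - _ - _ = 0
    rw [hgz]
    have ha' : a = (a.re : ℂ) := by
      apply Complex.ext <;> simp [ha_im]
    rw [ha']
    set d : ℂ := z - v with hd
    have hd2 : ‖d‖ ^ 2 = d.re ^ 2 + d.im ^ 2 := by rw [Complex.sq_norm, Complex.normSq_apply]; ring
    have hdnz : d.re ^ 2 + d.im ^ 2 ≠ 0 := by rw [← hd2]; exact hnorm
    rw [hd2]
    simp only [Complex.add_re, Complex.mul_re, Complex.add_im, Complex.div_re, Complex.div_im,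
      Complex.ofReal_re, Complex.ofReal_im, Complex.normSq_apply, Complex.conj_re, Complex.conj_im, nsmul_eq_mul,
      Nat.cast_ofNat]
    field_simp
    ring
  have hwd : DifferentiableOn ℝ w D := fun z hz => (hwderiv z hz).differentiableAt.differentiableWithinAt
  have hw0 : EqOn (fderiv ℝ w) 0 D := fun z hz => (hwderiv z hz).fderiv
  obtain ⟨κ, hκ⟩ := hDo.exists_is_const_of_fderiv_eq_zero (Literature.Topology.Euclidean.isPreconnected_ball_diff_singleton v R) hwd hw0
  -- Step 7: boundedness forces `a = 0`
  have hHc : ContinuousAt H v := (hH v (mem_ball_self hR)).continuousAt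
  obtain ⟨δ, hδ, hδH⟩ := Metric.continuousAt_iff.1 hHc 1 one_pos
  have ha_re : a.re = 0 := by
    by_contra hne
    have hapos : 0 < |a.re| := abs_pos.2 hne
    set t₀ : ℝ := Real.exp (-(M + |κ| + 2) / |a.re|) with ht₀
    set t : ℝ := min (δ / 2) (min (R / 2) t₀) with ht
    have ht0 : 0 < t := by positivity
    have htδ : t < δ := by
      have : t ≤ δ / 2 := min_le_left _ _
      linarith
    have htR : t < R := by
      have : t ≤ R / 2 := (min_le_right _ _).trans (min_le_left _ _)
      linarith
    have htt₀ : t ≤ t₀ := (min_le_right _ _).trans (min_le_right _ _)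
    set z : ℂ := v + t with hz
    have hzv : z - v = t := by rw [hz]; ring
    have hzD : z ∈ D := hmemD.2 ⟨by rw [dist_eq_norm, hzv, Complex.norm_real, Real.norm_eq_abs, abs_of_pos ht0]; exact htR,
      by
        intro h0
        have : (t : ℂ) = 0 := by rw [← hzv, h0, sub_self]
        exact ht0.ne' (by exact_mod_cast this)⟩
    have hwz : u z - a.re / 2 * Real.log (‖z - v‖ ^ 2) - (H z).re = κ := hκ z hzD
    have hHz : |(H z).re| ≤ 1 := by
      have hdist : dist z v < δ := by
        rw [dist_eq_norm, hzv, Complex.norm_real, Real.norm_eq_abs, abs_of_pos ht0]; exact htδ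
      have := hδH hdist
      rw [hH0, dist_zero_right] at this
      exact (abs_re_le_norm _).trans this.le
    have huz : |u z| ≤ M := hM z hzD
    rw [hzv, Complex.norm_real, Real.norm_eq_abs, abs_of_pos ht0, Real.log_pow, Nat.cast_ofNat] at hwz
    -- `a.re * log t = u z - Re H z - κ`
    have hlog : a.re * Real.log t = u z - (H z).re - κ := by linarith
    have hlogt : Real.log t ≤ -(M + |κ| + 2) / |a.re| := by
      calc Real.log t ≤ Real.log t₀ := Real.log_le_log ht0 htt₀
        _ = -(M + |κ| + 2) / |a.re| := by rw [ht₀, Real.log_exp]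
    have hneg : Real.log t < 0 := by
      have : -(M + |κ| + 2) / |a.re| < 0 := by
        apply div_neg_of_neg_of_pos _ hapos
        have := abs_nonneg κ
        have hM0 : 0 ≤ M := (abs_nonneg _).trans huz
        linarith
      linarith
    have hbig : M + |κ| + 2 ≤ |a.re| * |Real.log t| := by
      rw [abs_of_neg hneg]
      have := mul_le_mul_of_nonneg_left hlogt hapos.le
      rw [mul_div_cancel₀ _ hapos.ne'] at this
      linarith
    have hsmall' : |a.re| * |Real.log t| ≤ M + 1 + |κ| := by
      rw [← abs_mul, hlog]
      calc |u z - (H z).re - κ| ≤ |u z| + |(H z).re| + |κ| := by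
            calc |u z - (H z).re - κ| ≤ |u z - (H z).re| + |κ| := abs_sub _ _
              _ ≤ |u z| + |(H z).re| + |κ| := by gcongr; exact abs_sub _ _
        _ ≤ M + 1 + |κ| := by gcongr
    linarith
  -- Step 8: the harmonic extension `Re H + κ`
  refine ⟨fun z => (H z).re + κ, ?_, ?_⟩
  · intro z hz
    have han : AnalyticAt ℂ (fun w => H w + (κ : ℂ)) z :=
      (DifferentiableOn.analyticAt (fun w hw => (hH w hw).differentiableAt.differentiableWithinAt)
        (isOpen_ball.mem_nhds hz)).add analyticAt_const
    have hfun : (fun z => (H z).re + κ) = ⇑reCLM ∘ fun w => H w + (κ : ℂ) := by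
      funext w
      simp
    rw [hfun]
    exact han.harmonicAt.comp_CLM reCLM
  · intro z hz
    have hwz : u z - a.re / 2 * Real.log (‖z - v‖ ^ 2) - (H z).re = κ := hκ z hz
    rw [ha_re, zero_div, zero_mul, sub_zero] at hwz
    simp only
    linarith

end Literature.Analysis.Complex

end
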